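/-
Copyright (c) 2026 the pub-hodgecm-mathlib formalisation cell (harness21).  Prover seat hodgecm-mathlib-B-p14 (g42): the σ_w-currency BRIDGE of the wild quadratic layer
(adapter for the CM ∕ Rogawski-currency consumers; census F0P3a-p06 (g17) `DUNR-H2-CENSUS.md` §3); 2026-09-02.
-/
import Literature.NumberTheory.LocalFields.QuadraticLocalNormFixedRange      -- ★ (J2) `mem_range_algebraMap_place_iff_of_card_eq_two`, `galAdicCompletionMap_algebraMap_place`, `Place`
import Literature.NumberTheory.Automorphic.Liu2021.FinAdelicCheckSurjective   -- ★ `galAdicCompletionMap_galAdicCompletionMap_self` (involution)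
import Literature.NumberTheory.LocalFields.WildQuadraticNormGroupAPI          -- ★ the define-free layer: `conductor_exists_adicCompletion`, `conductor_iff_of_forall_mul_self_ne`, …
import HarnessLib

/-!
# Wild quadratic norms — the σ_w-CURRENCY BRIDGE: `x ∈ N_{E_w∕F_v} ⟺ ∃ a b ∈ F_v, a² − d b² = x` for a skew generator `δ` (`σ_w δ = −δ`, `δ² = d`),
# and the CONDUCTOR of `L_w ∕ L⁺_v` at a dyadic non-split place read in the `z · σ_w z` currency of the CM files

Topic `NumberTheory/LocalFields`; namespace `Literature.NumberTheory.LocalFields`.  THEOREMS ONLY (no definition, no instance, no notation, no named fact, no `sorry`);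
kernel lane `--supports stmt-HodgeConjecture-24833`.  Cell `pub/hodgecm-mathlib` (D-0151), crux H413 = `stmt-HodgeConjecture-24833`; half A line LH4, DYADIC pay-down leaf
`Cruxes/H413/Lines/F0_P3c_DyadicPaydown.lean`, organs (D-UNR)∕(D-RAM) (PRINT; census F0P3a-p06 (g17) OUTCOME B).  The wild quadratic layer (★ `WildQuadraticNormsNearOne` …
★ `WildQuadraticNormGroupAPI`, 8 files) speaks the DEFINE-FREE binary-form currency `∃ a b : F_v, a·a − d·(b·b) = x` over the completion `F_v`; the CM ∕ Rogawski files of the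
tree speak NORMS AS `z · σ_w z` inside `E_w` (★ (J1) `QuadraticPlaceNormIndexTwo`, ★ (J2) `QuadraticLocalNormFixedRange`, ★ (J3) `QuadraticLocalNormDichotomy`, every
`UnitaryGroup…CM` file).  THIS file is the adapter.  HONEST LABEL: HC_CM is proved only modulo the 7 printed citations (2 remaining named inputs: hLiu418 =
stmt-HodgeConjecture-24832, h413 = stmt-HodgeConjecture-24833) until rung 0 closes; count-neutral plumbing, no new mathematics.

SETTING (= ★ (J2) §2): `E ∕ F` Galois with `#Gal(E∕F) = 2`, non-trivial `c`, a finite place `v` of `F` and `w : Place F E v` with `c • w = w` (NON-SPLIT; unramified, tame or wild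
alike); `F_v = v.adicCompletion F ↪ E_w` by `algebraMap`, `σ_w = galAdicCompletionMap c hw`.  A SKEW GENERATOR is `δ ∈ E_w` with `σ_w δ = −δ`, `δ ≠ 0` — supplied by the consumer
(for a torus `T ⊂ U(2)` it is `√(disc γ)`; at inert places ★ `exists_galAdicCompletionMap_eq_neg_valued_eq_one` gives a skew unit) — and `d ∈ F_v` with `algebraMap d = δ·δ`.
* §1 `exists_mul_galAdicCompletionMap_eq_algebraMap_iff` — **`(∃ z : E_w, z·σ_w z = algebraMap x) ↔ ∃ a b : F_v, a·a − d·(b·b) = x`**: ⇐ `z = a + bδ`; ⇒ `a = (z + σz)∕2`,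
  `b = (z − σz)∕(2δ)` are `σ_w`-fixed (★ involution `σ_w² = 1`), hence from `F_v` (★ `Fix(σ_w) = F_v`), and `z = a + bδ`.  Also `forall_mul_self_ne_of_skew`: `d` is NOT a square
  in `F_v`, and `ne_zero_of_skew`: `d ≠ 0` — the two hypotheses of the ★ API.
* §2 `IsCMField.exists_mul_galAdicCompletionMap_eq_iff_sq_sub_mul_sq` ∕ `IsCMField.…` dresses (`L ∕ L⁺`, `σ_w = galAdicCompletionMap (IsCMField.complexConj L) hw`) and **the CONDUCTOR of `L_w ∕ L⁺_v` at a DYADIC non-split place in σ-currency**: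
  `IsCMField.conductor_exists_place` (`∃ f : ℕ`, `v(4ϖ) ≤ exp(−f)`, `U^{(f)}(L⁺_v) ⊆ {x : ∃ z, z·σ_w z = x}`, `f = 0` or a sharp non-norm unit of depth `exp(−(f−1))`) and
  `IsCMField.conductor_iff_place` (`U^{(k)} ⊆ N ⟺ f ≤ k`) — ★ `conductor_exists_adicCompletion` ∕ `conductor_iff_of_forall_mul_self_ne` through §1.  Value table by the class of
  `d = δ²`: `0` (`4𝒪`-defect class: `w` UNRAMIFIED), `2e+1−s` (odd defect `s`), `2e+1` (odd order) — the two WILD RAMIFIED cases at `w ∣ 2`.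
* §2 also: `IsCMField.exists_skew_generator_place` (no `√−D` input needed) and the two WILD HEADS in the tame consumers' binder shape minus tameness —
  `IsCMField.norm_filtration_place_of_valued_odd` (`f = 2e+1`) and `IsCMField.norm_filtration_place_of_odd_defect` (`f = 2e+1−s`), each with the sharp non-norm unit.
(The norm INDEX in σ-currency is already ★ by the Herbrand road — (J1) `index_range_norm_place_eq_two`, (J3) `exists_fixed_nonnorm_dichotomy` — and is not restated; «units are norms» at
an UNRAMIFIED place is ★ `UnramifiedQuadraticNorm.exists_mul_map_eq_of_finite_residueField` and is not restated.)  HONEST READER LABEL: consumers = the (D-RAM) wild base layer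
(p06 (g17) memo §4) — nothing live this week: (D-UNR)∕(D-RAM) are PRINT organs by ruling D74′; filed as the σ-currency adapter of the 8-file conductor layer ★ p850401 … p850671.

## References
* [Serre1979] J.-P. Serre, *Local Fields*, GTM 67 (1979), Ch. XV §2 (norm groups and conductors); Ch. XIV §4.
* [CasselsFrohlichANT1967] J. W. S. Cassels, A. Fröhlich (eds.), *Algebraic Number Theory* (1967), Ch. VII (Tate) §1.1 (`G_w = Gal(E_w∕F_v)`).
* [NeukirchANT1999] J. Neukirch, *Algebraic Number Theory* (1999), Ch. II (9.6), Ch. V (1.3).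
-/

set_option autoImplicit false

noncomputable section

open scoped Valued WithZero
open WithZero NumberField IsDedekindDomain
open Literature.NumberTheory.Automorphic Literature.NumberTheory.GaloisRepresentations
open Literature.NumberTheory.GaloisRepresentations.SemiLocal

namespace Literature.NumberTheory.LocalFields

section Quadratic

variable {F : Type} [Field F] [NumberField F] {E : Type} [Field E] [NumberField E] [Algebra F E] {v : HeightOneSpectrum (𝓞 F)}
  [IsGalois F E] (hG : Nat.card (E ≃ₐ[F] E) = 2) (w : Place F E v) {c : E ≃ₐ[F] E} (hc : c ≠ 1) (hw : c • (w : HeightOneSpectrum (𝓞 E)) = w)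

omit [NumberField F] [NumberField E] [IsGalois F E] in
/-- In a group of order `2` the non-trivial element is an involution: `c * c = 1`. [cite: CasselsFrohlichANT1967, Ch. VII §1.1] -/
theorem mul_self_eq_one_of_card_eq_two (hG : Nat.card (E ≃ₐ[F] E) = 2) (c : E ≃ₐ[F] E) : c * c = 1 := by
  rw [← pow_two]
  exact orderOf_dvd_iff_pow_eq_one.1 (hG ▸ orderOf_dvd_natCard c)

omit [IsGalois F E] in
/-- A skew generator forces `d ≠ 0`: if `σ_w δ = −δ`, `δ ≠ 0` and `algebraMap d = δ·δ` then `d ≠ 0`. [cite: CasselsFrohlichANT1967, Ch. VII §1.1] -/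
theorem ne_zero_of_skew {δ : (w : HeightOneSpectrum (𝓞 E)).adicCompletion E} (hδ0 : δ ≠ 0) {d : v.adicCompletion F}
    (hd : algebraMap (v.adicCompletion F) ((w : HeightOneSpectrum (𝓞 E)).adicCompletion E) d = δ * δ) : d ≠ 0 := by
  rintro rfl
  rw [map_zero] at hd
  exact mul_ne_zero hδ0 hδ0 hd.symm

include hG hc hw

omit [IsGalois F E] hG hc in
/-- A skew generator's square `d` is NOT A SQUARE in `F_v`: `r·r = d` would give `(algebraMap r − δ)(algebraMap r + δ) = 0`, so `δ = ±algebraMap r` is `σ_w`-fixed, i.e.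
`δ = −δ`, `δ = 0`. [cite: CasselsFrohlichANT1967, Ch. VII §1.1] -/
theorem forall_mul_self_ne_of_skew {δ : (w : HeightOneSpectrum (𝓞 E)).adicCompletion E}
    (hδ : galAdicCompletionMap (L := E) c hw δ = -δ) (hδ0 : δ ≠ 0) {d : v.adicCompletion F}
    (hd : algebraMap (v.adicCompletion F) ((w : HeightOneSpectrum (𝓞 E)).adicCompletion E) d = δ * δ) : ∀ r : v.adicCompletion F, r * r ≠ d := by
  intro r hr
  have h2 : (2 : (w : HeightOneSpectrum (𝓞 E)).adicCompletion E) ≠ 0 := by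
    rw [show (2 : (w : HeightOneSpectrum (𝓞 E)).adicCompletion E) = algebraMap E _ 2 by rw [map_ofNat]]
    exact (_root_.map_ne_zero (algebraMap E ((w : HeightOneSpectrum (𝓞 E)).adicCompletion E))).2 two_ne_zero
  set ρ := algebraMap (v.adicCompletion F) ((w : HeightOneSpectrum (𝓞 E)).adicCompletion E) r with hρ
  have hρσ : galAdicCompletionMap (L := E) c hw ρ = ρ := galAdicCompletionMap_algebraMap_place w c hw r
  have hfac : (ρ - δ) * (ρ + δ) = 0 := by
    rw [show (ρ - δ) * (ρ + δ) = ρ * ρ - δ * δ by ring, ← hd, hρ, ← map_mul, hr, sub_self]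
  have hfix : galAdicCompletionMap (L := E) c hw δ = δ := by
    rcases mul_eq_zero.1 hfac with h | h
    · rw [sub_eq_zero] at h
      rw [← h, hρσ]
    · have hδρ : δ = -ρ := (neg_eq_of_add_eq_zero_right h).symm
      rw [hδρ, map_neg, hρσ]
  rw [hδ] at hfix
  have h2δ : (2 : (w : HeightOneSpectrum (𝓞 E)).adicCompletion E) * δ = 0 := by linear_combination (-1 : _) * hfix
  rcases mul_eq_zero.1 h2δ with h | h
  · exact h2 h
  · exact hδ0 h

/-- **A SKEW GENERATOR EXISTS** at every non-split place of a quadratic extension (no `√−D` input): `σ_w ≠ id` on `E_w` (★ `exists_galAdicCompletionMap_ne`), so for some `a`,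
`δ := a − σ_w a ≠ 0` has `σ_w δ = −δ`, and `δ·δ` is `σ_w`-fixed, hence `= algebraMap d` for some `d ∈ F_v` (★ `Fix(σ_w) = F_v`). [cite: CasselsFrohlichANT1967, Ch. VII §1.1] -/
theorem exists_skew_generator_place :
    ∃ (δ : (w : HeightOneSpectrum (𝓞 E)).adicCompletion E) (d : v.adicCompletion F),
      galAdicCompletionMap (L := E) c hw δ = -δ ∧ δ ≠ 0 ∧ algebraMap (v.adicCompletion F) ((w : HeightOneSpectrum (𝓞 E)).adicCompletion E) d = δ * δ := by
  obtain ⟨a, ha⟩ := Liu2021.exists_galAdicCompletionMap_ne F E c hc hw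
  have hσσ : ∀ y, galAdicCompletionMap (L := E) c hw (galAdicCompletionMap (L := E) c hw y) = y := fun y =>
    Liu2021.galAdicCompletionMap_galAdicCompletionMap_self F E c (mul_self_eq_one_of_card_eq_two hG c) hw y
  have hδ : galAdicCompletionMap (L := E) c hw (a - galAdicCompletionMap (L := E) c hw a) = -(a - galAdicCompletionMap (L := E) c hw a) := by
    rw [map_sub, hσσ, neg_sub]
  have hδ0 : a - galAdicCompletionMap (L := E) c hw a ≠ 0 := fun h => ha (sub_eq_zero.1 h).symm
  have hfix : galAdicCompletionMap (L := E) c hw ((a - galAdicCompletionMap (L := E) c hw a) * (a - galAdicCompletionMap (L := E) c hw a)) =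
      (a - galAdicCompletionMap (L := E) c hw a) * (a - galAdicCompletionMap (L := E) c hw a) := by
    rw [map_mul, hδ, neg_mul_neg]
  obtain ⟨d, hd⟩ := exists_algebraMap_place_eq_of_card_eq_two hG w hc hw hfix
  exact ⟨_, d, hδ, hδ0, hd⟩

/-- **THE σ_w-BRIDGE**: at a non-split place `w` of a quadratic extension `E ∕ F`, with a skew generator `δ` (`σ_w δ = −δ`, `δ ≠ 0`, `algebraMap d = δ·δ`), an element `x ∈ F_v` is a
NORM from `E_w` in the `z · σ_w z` currency iff it is represented by the binary form of the define-free layer: `(∃ z : E_w, z · σ_w z = algebraMap x) ↔ ∃ a b : F_v, a·a − d·(b·b) = x`.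
(⇐ `z = a + bδ`; ⇒ `a = (z + σz)∕2`, `b = (z − σz)∕(2δ)` are `σ_w`-fixed, hence in `F_v` by ★ `Fix(σ_w) = F_v`.) [cite: CasselsFrohlichANT1967, Ch. VII §1.1] [cite: Serre1979, Ch. XV §2] -/
theorem exists_mul_galAdicCompletionMap_eq_algebraMap_iff {δ : (w : HeightOneSpectrum (𝓞 E)).adicCompletion E}
    (hδ : galAdicCompletionMap (L := E) c hw δ = -δ) (hδ0 : δ ≠ 0) {d : v.adicCompletion F}
    (hd : algebraMap (v.adicCompletion F) ((w : HeightOneSpectrum (𝓞 E)).adicCompletion E) d = δ * δ) (x : v.adicCompletion F) :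
    (∃ z : (w : HeightOneSpectrum (𝓞 E)).adicCompletion E,
        z * galAdicCompletionMap (L := E) c hw z = algebraMap (v.adicCompletion F) ((w : HeightOneSpectrum (𝓞 E)).adicCompletion E) x) ↔
      ∃ a b : v.adicCompletion F, a * a - d * (b * b) = x := by
  set ι := algebraMap (v.adicCompletion F) ((w : HeightOneSpectrum (𝓞 E)).adicCompletion E) with hι
  set σ := galAdicCompletionMap (L := E) c hw with hσ
  have hσι : ∀ y, σ (ι y) = ι y := fun y => galAdicCompletionMap_algebraMap_place w c hw y
  have hσσ : ∀ y, σ (σ y) = y := fun y =>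
    Liu2021.galAdicCompletionMap_galAdicCompletionMap_self F E c (mul_self_eq_one_of_card_eq_two hG c) hw y
  have h2 : (2 : (w : HeightOneSpectrum (𝓞 E)).adicCompletion E) ≠ 0 := by
    rw [show (2 : (w : HeightOneSpectrum (𝓞 E)).adicCompletion E) = algebraMap E _ 2 by rw [map_ofNat]]
    exact (_root_.map_ne_zero (algebraMap E ((w : HeightOneSpectrum (𝓞 E)).adicCompletion E))).2 two_ne_zero
  constructor
  · rintro ⟨z, hz⟩
    -- `a' = (z + σz)∕2`, `b' = (z − σz)∕(2δ)` are σ-fixed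
    have ha' : σ ((z + σ z) * (2 : _)⁻¹) = (z + σ z) * (2 : _)⁻¹ := by
      rw [map_mul, map_add, hσσ, map_inv₀, map_ofNat, add_comm]
    have hb' : σ ((z - σ z) * (2 * δ)⁻¹) = (z - σ z) * (2 * δ)⁻¹ := by
      rw [map_mul, map_sub, hσσ, map_inv₀, map_mul, map_ofNat, hδ]
      field_simp
      ring
    obtain ⟨a, ha⟩ := exists_algebraMap_place_eq_of_card_eq_two hG w hc hw ha'
    obtain ⟨b, hb⟩ := exists_algebraMap_place_eq_of_card_eq_two hG w hc hw hb'
    refine ⟨a, b, (algebraMap (v.adicCompletion F) ((w : HeightOneSpectrum (𝓞 E)).adicCompletion E)).injective ?_⟩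
    rw [map_sub, map_mul, map_mul, map_mul, hd, ← hι, ha, hb, ← hz]
    field_simp
    ring
  · rintro ⟨a, b, hab⟩
    refine ⟨ι a + ι b * δ, ?_⟩
    rw [map_add, map_mul, hσι, hσι, hδ, ← hab, map_sub, map_mul, map_mul, map_mul, hd]
    ring

end Quadratic

/-! ## §2 CM fields `L ∕ L⁺`: the bridge and the CONDUCTOR at a dyadic non-split place in `σ_w`-currency -/
section CM

variable (L : Type) [Field L] [NumberField L] [IsCMField L] {v : HeightOneSpectrum (𝓞 ↥(maximalRealSubfield L))}
  (w : Place ↥(maximalRealSubfield L) L v) (hw : IsCMField.complexConj L • (w : HeightOneSpectrum (𝓞 L)) = w)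

/-- `#Gal(L ∕ L⁺) = 2` (private bookkeeping, as in ★ (J2)). [cite: NeukirchANT1999, Ch. II (9.6)] -/
private theorem IsCMField.natCard_algEquiv_eq_two' : Nat.card (L ≃ₐ[↥(maximalRealSubfield L)] L) = 2 := by
  rw [IsGalois.card_aut_eq_finrank, Algebra.IsQuadraticExtension.finrank_eq_two]

include hw

/-- **THE σ_w-BRIDGE FOR A CM FIELD** at a non-split place (`complexConj L • w = w`): with a skew generator `δ ∈ L_w` (`σ_w δ = −δ`, `δ ≠ 0`, `algebraMap d = δ·δ`),
`(∃ z : L_w, z · σ_w z = algebraMap x) ↔ ∃ a b : L⁺_v, a·a − d·(b·b) = x`. [cite: CasselsFrohlichANT1967, Ch. VII §1.1] [cite: Serre1979, Ch. XV §2] -/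
theorem IsCMField.exists_mul_galAdicCompletionMap_eq_iff_sq_sub_mul_sq {δ : (w : HeightOneSpectrum (𝓞 L)).adicCompletion L}
    (hδ : galAdicCompletionMap (L := L) (IsCMField.complexConj L) hw δ = -δ) (hδ0 : δ ≠ 0) {d : v.adicCompletion ↥(maximalRealSubfield L)}
    (hd : algebraMap (v.adicCompletion ↥(maximalRealSubfield L)) ((w : HeightOneSpectrum (𝓞 L)).adicCompletion L) d = δ * δ)
    (x : v.adicCompletion ↥(maximalRealSubfield L)) :
    (∃ z : (w : HeightOneSpectrum (𝓞 L)).adicCompletion L, z * galAdicCompletionMap (L := L) (IsCMField.complexConj L) hw z =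
        algebraMap (v.adicCompletion ↥(maximalRealSubfield L)) ((w : HeightOneSpectrum (𝓞 L)).adicCompletion L) x) ↔
      ∃ a b : v.adicCompletion ↥(maximalRealSubfield L), a * a - d * (b * b) = x :=
  Literature.NumberTheory.LocalFields.exists_mul_galAdicCompletionMap_eq_algebraMap_iff (IsCMField.natCard_algEquiv_eq_two' L) w
    (IsCMField.complexConj_ne_one L) hw hδ hδ0 hd x

/-- **THE CONDUCTOR OF `L_w ∕ L⁺_v` AT A DYADIC NON-SPLIT PLACE, σ_w-currency**: `L` CM, `complexConj L • w = w`, `v ∣ 2` (`v(2) < 1` in `L⁺_v`), a uniformiser `ϖ` of `L⁺_v`, a skew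
generator `δ ∈ L_w` with `algebraMap d = δ·δ`.  There is `f : ℕ` with `v(4ϖ) ≤ exp(−f)` (`f ≤ 2e + 1`), every unit `x ∈ L⁺_v` of depth `≥ f` a NORM `z·σ_w z`, and `f = 0` or a
unit of depth exactly `exp(−(f−1))` that is NOT a norm: the Artin conductor of `L_w ∕ L⁺_v` (`0` iff `w` unramified; `2e+1−s` ∕ `2e+1` in the wild ramified cases, by the class
of `d`).  (★ `conductor_exists_adicCompletion` through the bridge.) [cite: Serre1979, Ch. XV §2] [cite: NeukirchANT1999, Ch. V (1.3)] -/
theorem IsCMField.conductor_exists_place (h2v : Valued.v (2 : v.adicCompletion ↥(maximalRealSubfield L)) < 1)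
    {ϖ : v.adicCompletion ↥(maximalRealSubfield L)} (hϖ : Valued.v ϖ = exp (-1 : ℤ))
    {δ : (w : HeightOneSpectrum (𝓞 L)).adicCompletion L} (hδ : galAdicCompletionMap (L := L) (IsCMField.complexConj L) hw δ = -δ) (hδ0 : δ ≠ 0)
    {d : v.adicCompletion ↥(maximalRealSubfield L)}
    (hd : algebraMap (v.adicCompletion ↥(maximalRealSubfield L)) ((w : HeightOneSpectrum (𝓞 L)).adicCompletion L) d = δ * δ) :
    ∃ f : ℕ, Valued.v ((4 : v.adicCompletion ↥(maximalRealSubfield L)) * ϖ) ≤ exp (-(f : ℤ)) ∧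
      (∀ x : v.adicCompletion ↥(maximalRealSubfield L), Valued.v x = 1 → Valued.v (x - 1) ≤ exp (-(f : ℤ)) →
        ∃ z : (w : HeightOneSpectrum (𝓞 L)).adicCompletion L, z * galAdicCompletionMap (L := L) (IsCMField.complexConj L) hw z =
          algebraMap (v.adicCompletion ↥(maximalRealSubfield L)) ((w : HeightOneSpectrum (𝓞 L)).adicCompletion L) x) ∧
      (f = 0 ∨ ∃ x : v.adicCompletion ↥(maximalRealSubfield L), Valued.v x = 1 ∧ Valued.v (x - 1) = exp (-((f : ℤ) - 1)) ∧
        ¬ ∃ z : (w : HeightOneSpectrum (𝓞 L)).adicCompletion L, z * galAdicCompletionMap (L := L) (IsCMField.complexConj L) hw z =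
          algebraMap (v.adicCompletion ↥(maximalRealSubfield L)) ((w : HeightOneSpectrum (𝓞 L)).adicCompletion L) x) := by
  have hbridge := IsCMField.exists_mul_galAdicCompletionMap_eq_iff_sq_sub_mul_sq L w hw hδ hδ0 hd
  have hns := Literature.NumberTheory.LocalFields.forall_mul_self_ne_of_skew w hw hδ hδ0 hd
  have hd0 := Literature.NumberTheory.LocalFields.ne_zero_of_skew w hδ0 hd
  obtain ⟨f, hfb, hN, hmin⟩ := conductor_exists_adicCompletion ↥(maximalRealSubfield L) v h2v hϖ hd0 hns
  refine ⟨f, hfb, fun x hx hxf => (hbridge x).2 (hN x hx hxf), ?_⟩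
  rcases hmin with h0 | ⟨x, hx1, hxd, hxN⟩
  · exact Or.inl h0
  · exact Or.inr ⟨x, hx1, hxd, fun h => hxN ((hbridge x).1 h)⟩

/-- **THE CONDUCTOR AS THE LEAST FILTRATION INDEX, σ_w-currency** (consumer form): with `f` as in `IsCMField.conductor_exists_place`, for every `k : ℕ`,
`U^{(k)}(L⁺_v) ⊆ N_{L_w∕L⁺_v} ⟺ f ≤ k`. [cite: Serre1979, Ch. XV §2] -/
theorem IsCMField.conductor_iff_place (h2v : Valued.v (2 : v.adicCompletion ↥(maximalRealSubfield L)) < 1)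
    {ϖ : v.adicCompletion ↥(maximalRealSubfield L)} (hϖ : Valued.v ϖ = exp (-1 : ℤ))
    {δ : (w : HeightOneSpectrum (𝓞 L)).adicCompletion L} (hδ : galAdicCompletionMap (L := L) (IsCMField.complexConj L) hw δ = -δ) (hδ0 : δ ≠ 0)
    {d : v.adicCompletion ↥(maximalRealSubfield L)}
    (hd : algebraMap (v.adicCompletion ↥(maximalRealSubfield L)) ((w : HeightOneSpectrum (𝓞 L)).adicCompletion L) d = δ * δ) :
    ∃ f : ℕ, Valued.v ((4 : v.adicCompletion ↥(maximalRealSubfield L)) * ϖ) ≤ exp (-(f : ℤ)) ∧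
      ∀ k : ℕ, (∀ x : v.adicCompletion ↥(maximalRealSubfield L), Valued.v x = 1 → Valued.v (x - 1) ≤ exp (-(k : ℤ)) →
        ∃ z : (w : HeightOneSpectrum (𝓞 L)).adicCompletion L, z * galAdicCompletionMap (L := L) (IsCMField.complexConj L) hw z =
          algebraMap (v.adicCompletion ↥(maximalRealSubfield L)) ((w : HeightOneSpectrum (𝓞 L)).adicCompletion L) x) ↔ f ≤ k := by
  obtain ⟨f, hfb, hN, hmin⟩ := IsCMField.conductor_exists_place L w hw h2v hϖ hδ hδ0 hd
  refine ⟨f, hfb, fun k => ⟨fun hk => ?_, fun hfk x hx hxk => hN x hx (hxk.trans (by rw [exp_le_exp]; omega))⟩⟩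
  by_contra hlt
  rw [not_le] at hlt
  rcases hmin with hf0 | ⟨x, hx1, hxd, hxN⟩
  · omega
  · exact hxN (hk x hx1 (by rw [hxd, exp_le_exp]; omega))

/-- **A SKEW GENERATOR EXISTS (CM dress)**: at a non-split place of `L ∕ L⁺` there are `δ ∈ L_w`, `d ∈ L⁺_v` with `σ_w δ = −δ`, `δ ≠ 0`, `algebraMap d = δ·δ`.
[cite: CasselsFrohlichANT1967, Ch. VII §1.1] -/
theorem IsCMField.exists_skew_generator_place :
    ∃ (δ : (w : HeightOneSpectrum (𝓞 L)).adicCompletion L) (d : v.adicCompletion ↥(maximalRealSubfield L)),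
      galAdicCompletionMap (L := L) (IsCMField.complexConj L) hw δ = -δ ∧ δ ≠ 0 ∧
        algebraMap (v.adicCompletion ↥(maximalRealSubfield L)) ((w : HeightOneSpectrum (𝓞 L)).adicCompletion L) d = δ * δ :=
  Literature.NumberTheory.LocalFields.exists_skew_generator_place (IsCMField.natCard_algEquiv_eq_two' L) w (IsCMField.complexConj_ne_one L) hw

/-- **WILD HEAD I — `d` OF ODD ORDER (`f = 2e + 1`), σ_w-currency** (the binder shape of the tame consumers ★ `exists_fixed_unit_norm_dichotomy_of_ramified_complexConj … hv2` MINUS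
tameness: `v ∣ 2`, `complexConj L • w = w`, a skew generator `δ` with `algebraMap d = δ·δ`, `v d` not a square value): every `x ∈ L⁺_v` with `v(x − 1) < v 4` is a norm `z·σ_w z`,
and some UNIT `x` with `v(x − 1) = v 4` is not (★ `conductor_of_valued_odd` through the bridge). [cite: Serre1979, Ch. XIV §4; Ch. XV §2] [cite: Omeara1963, §63B 63:11a] -/
theorem IsCMField.norm_filtration_place_of_valued_odd (h2v : Valued.v (2 : v.adicCompletion ↥(maximalRealSubfield L)) < 1)
    {δ : (w : HeightOneSpectrum (𝓞 L)).adicCompletion L} (hδ : galAdicCompletionMap (L := L) (IsCMField.complexConj L) hw δ = -δ) (hδ0 : δ ≠ 0)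
    {d : v.adicCompletion ↥(maximalRealSubfield L)}
    (hd : algebraMap (v.adicCompletion ↥(maximalRealSubfield L)) ((w : HeightOneSpectrum (𝓞 L)).adicCompletion L) d = δ * δ)
    (hdodd : ∀ y : v.adicCompletion ↥(maximalRealSubfield L), Valued.v d ≠ Valued.v y * Valued.v y) :
    (∀ x : v.adicCompletion ↥(maximalRealSubfield L), Valued.v (x - 1) < Valued.v (4 : v.adicCompletion ↥(maximalRealSubfield L)) →
        ∃ z : (w : HeightOneSpectrum (𝓞 L)).adicCompletion L, z * galAdicCompletionMap (L := L) (IsCMField.complexConj L) hw z =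
          algebraMap (v.adicCompletion ↥(maximalRealSubfield L)) ((w : HeightOneSpectrum (𝓞 L)).adicCompletion L) x) ∧
      ∃ x : v.adicCompletion ↥(maximalRealSubfield L), Valued.v x = 1 ∧ Valued.v (x - 1) = Valued.v (4 : v.adicCompletion ↥(maximalRealSubfield L)) ∧
        ¬ ∃ z : (w : HeightOneSpectrum (𝓞 L)).adicCompletion L, z * galAdicCompletionMap (L := L) (IsCMField.complexConj L) hw z =
          algebraMap (v.adicCompletion ↥(maximalRealSubfield L)) ((w : HeightOneSpectrum (𝓞 L)).adicCompletion L) x := by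
  haveI := Literature.NumberTheory.Automorphic.isAdicComplete_valuedMaximalIdeal_valuedInteger_adicCompletion ↥(maximalRealSubfield L) v
  haveI : Finite 𝓀[v.adicCompletion ↥(maximalRealSubfield L)] :=
    Literature.NumberTheory.Automorphic.finite_residueField_adicCompletion ↥(maximalRealSubfield L) v
  have h2 : (2 : v.adicCompletion ↥(maximalRealSubfield L)) ≠ 0 := by
    rw [show (2 : v.adicCompletion ↥(maximalRealSubfield L)) = algebraMap ↥(maximalRealSubfield L) _ 2 by rw [map_ofNat]]
    exact (_root_.map_ne_zero (algebraMap ↥(maximalRealSubfield L) (v.adicCompletion ↥(maximalRealSubfield L)))).2 two_ne_zero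
  have hbridge := IsCMField.exists_mul_galAdicCompletionMap_eq_iff_sq_sub_mul_sq L w hw hδ hδ0 hd
  obtain ⟨hW1, x, hx1, hxd, hxN⟩ := conductor_of_valued_odd h2 h2v hdodd
  exact ⟨fun x hx => (hbridge x).2 (hW1 x hx), x, hx1, hxd, fun h => hxN ((hbridge x).1 h)⟩

/-- **WILD HEAD II — `d = 1 + w′` A UNIT OF ODD DEFECT `s` (`f = 2e + 1 − s`), σ_w-currency**: `v ∣ 2`, `complexConj L • w = w`, skew `δ` with `algebraMap (1 + w′) = δ·δ`,
`v 4 < v w′ < 1`, `v w′` odd.  Every `x ∈ L⁺_v` with `v(w′·(x − 1)) < v 4` (depth `≥ 2e + 1 − s`) is a norm `z·σ_w z`, and some unit `x` with `v(w′·(x − 1)) = v 4` (depth exactly `2e − s`)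
is not (★ `conductor_one_add_of_odd_defect` through the bridge).  A future (D-RAM) file swaps this name for ★ `RamifiedQuadraticNorm.exists_mul_map_eq_iff_isSquare_residue`.
[cite: Serre1979, Ch. XIV §4; Ch. XV §2] [cite: Omeara1963, §63B 63:11a] -/
theorem IsCMField.norm_filtration_place_of_odd_defect (h2v : Valued.v (2 : v.adicCompletion ↥(maximalRealSubfield L)) < 1)
    {δ : (w : HeightOneSpectrum (𝓞 L)).adicCompletion L} (hδ : galAdicCompletionMap (L := L) (IsCMField.complexConj L) hw δ = -δ) (hδ0 : δ ≠ 0)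
    {w' : v.adicCompletion ↥(maximalRealSubfield L)}
    (hd : algebraMap (v.adicCompletion ↥(maximalRealSubfield L)) ((w : HeightOneSpectrum (𝓞 L)).adicCompletion L) (1 + w') = δ * δ)
    (hw1 : Valued.v w' < 1) (h4w : Valued.v (4 : v.adicCompletion ↥(maximalRealSubfield L)) < Valued.v w')
    (hwodd : ∀ y : v.adicCompletion ↥(maximalRealSubfield L), Valued.v w' ≠ Valued.v y * Valued.v y) :
    (∀ x : v.adicCompletion ↥(maximalRealSubfield L), Valued.v (w' * (x - 1)) < Valued.v (4 : v.adicCompletion ↥(maximalRealSubfield L)) →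
        ∃ z : (w : HeightOneSpectrum (𝓞 L)).adicCompletion L, z * galAdicCompletionMap (L := L) (IsCMField.complexConj L) hw z =
          algebraMap (v.adicCompletion ↥(maximalRealSubfield L)) ((w : HeightOneSpectrum (𝓞 L)).adicCompletion L) x) ∧
      ∃ x : v.adicCompletion ↥(maximalRealSubfield L), Valued.v x = 1 ∧
        Valued.v (w' * (x - 1)) = Valued.v (4 : v.adicCompletion ↥(maximalRealSubfield L)) ∧
        ¬ ∃ z : (w : HeightOneSpectrum (𝓞 L)).adicCompletion L, z * galAdicCompletionMap (L := L) (IsCMField.complexConj L) hw z =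
          algebraMap (v.adicCompletion ↥(maximalRealSubfield L)) ((w : HeightOneSpectrum (𝓞 L)).adicCompletion L) x := by
  haveI := Literature.NumberTheory.Automorphic.isAdicComplete_valuedMaximalIdeal_valuedInteger_adicCompletion ↥(maximalRealSubfield L) v
  haveI : Finite 𝓀[v.adicCompletion ↥(maximalRealSubfield L)] :=
    Literature.NumberTheory.Automorphic.finite_residueField_adicCompletion ↥(maximalRealSubfield L) v
  have h2 : (2 : v.adicCompletion ↥(maximalRealSubfield L)) ≠ 0 := by
    rw [show (2 : v.adicCompletion ↥(maximalRealSubfield L)) = algebraMap ↥(maximalRealSubfield L) _ 2 by rw [map_ofNat]]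
    exact (_root_.map_ne_zero (algebraMap ↥(maximalRealSubfield L) (v.adicCompletion ↥(maximalRealSubfield L)))).2 two_ne_zero
  have hbridge := IsCMField.exists_mul_galAdicCompletionMap_eq_iff_sq_sub_mul_sq L w hw hδ hδ0 hd
  obtain ⟨hC1, x, hx1, hxd, hxN⟩ := conductor_one_add_of_odd_defect h2 h2v hw1 h4w hwodd
  exact ⟨fun x hx => (hbridge x).2 (hC1 x hx), x, hx1, hxd, fun h => hxN ((hbridge x).1 h)⟩

end CM


end Literature.NumberTheory.LocalFields

end
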